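import Summits.Ventures.PercRepro.ProfileGapMonoThresholdLongFlat

/-!
# PercRepro — THE BOUNDARY PAIR IDENTITY: the slack of the threshold family is carried by the rank-`(q−1)` sets at
co-rank EXACTLY `t` (p5, gen 30; `proofs/P5-GM1.md` §40(g); announced INBOX 13953)

`sum_slack_eq_add_boundary` (ProfileGapMonoThresholdLongFlat) writes the slack of `(I_t)` as
`Σ_{T_t} (q − κ(S)) + Σ_{S ∈ T_t, ρ(E∖S) = t} #(coloops(S) ∩ cl(E ∖ S))`.  The boundary sum is a count of pairs
`(S, a)` — `S` a rank-`q` set of co-rank exactly `t`, `a` a coloop of `S` lying in `cl(E ∖ S)` — and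
`(S, a) ↦ (S ∖ a, a)` is a bijection onto the pairs `(B′, a)` with `B′` a rank-`(q−1)` set of co-rank EXACTLY `t`
(one below the demand threshold) and `a ∉ cl B′` a NON-coloop of `E ∖ B′` (`a ∈ cl((E ∖ B′) ∖ a)`): indeed
`ρ(E ∖ B′) = ρ((E ∖ S) ∪ a) = ρ(E ∖ S)` exactly when `a ∈ cl(E ∖ S)`, and `a` is a coloop of `S = B′ ∪ a` exactly when
`a ∉ cl B′`.  Hence **`sum_card_boundary_pairs_eq`**:
`Σ_{B′ : ρ(B′) = q−1, ρ(E∖B′) = t} #((E ∖ cl B′) ∖ coloops(E ∖ B′)) = Σ_{S ∈ T_t, ρ(E∖S) = t} #(coloops(S) ∩ cl(E ∖ S))`,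
and the excess form of `(I_t)` becomes a statement about rank-`(q−1)` sets alone, up to the dependence slack of the
rank-`q` sets (**`thresholdIneq_iff_excess_coRank`**):
`(I_t) ⟺ Σ_{B ∈ L_t} ρ(E ∖ B) ≤ Σ_{B ∈ L_t} #(E ∖ cl B) + Σ_{T_t} (q − κ(S)) + Σ_{B′ at co-rank t} #((E ∖ cl B′) ∖ coloops(E ∖ B′))`
— the demanding sets (co-rank `≥ t + 1`) are paid by the dependent rank-`q` sets and by the sets just below the
threshold (co-rank `= t`), one unit per outside non-coloop.  Nothing open is asserted.
-/

open scoped Matroid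

namespace PercRepro.Cogirth

open Finset ThmH Skew Shadow Profile

variable {α : Type} [DecidableEq α] {N : Matroid α} [N.Finite]

section BoundaryPairs

variable {q t : ℕ}

/-- The complement of `B ∪ y` is the complement of `B` without `y`. -/
theorem sdiff_insert_eq_sdiff_erase (B : Finset α) (y : α) :
    gr N \ insert y B = (gr N \ B).erase y := by
  ext z
  simp only [mem_sdiff, mem_insert, mem_erase, not_or]
  tauto

/-- A point `y ∉ cl B` raises the rank of `B ⊆ E` by one. -/
theorem rk_insert_of_mem_sdiff_clF {B : Finset α} (hB : B ⊆ gr N) {y : α} (hy : y ∈ gr N \ clF N B) :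
    rk N (insert y B) = rk N B + 1 := by
  rw [rk_insert_eq (mem_sdiff.1 hy).1 hB, if_neg (mem_sdiff.1 hy).2]

/-- **The pair `(B′, y)` lands on a boundary target**: for `B′ ∈ Rq N (q − 1)` with `ρ(E ∖ B′) = t`, a point
`y ∉ cl B′` that is not a coloop of `E ∖ B′` gives `B′ ∪ y ∈ T_t` with `ρ(E ∖ (B′ ∪ y)) = t` (`1 ≤ q`). -/
theorem insert_mem_boundary_of_notMem_coloops (hq : 1 ≤ q) {B : Finset α} (hB : B ∈ Rq N (q - 1))
    (hBt : rk N (gr N \ B) = t) {y : α} (hy : y ∈ (gr N \ clF N B) \ coloops N (gr N \ B)) :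
    insert y B ∈ (levelSetCoQ N t q).filter (fun S => rk N (gr N \ S) = t) := by
  obtain ⟨hBg, hBr⟩ := mem_Rq.1 hB
  have hBrk : rk N B = q - 1 := rk_eq_of_eRk_eq_cq hBr
  rw [mem_sdiff] at hy
  have hycl := hy.1
  have hyg : y ∈ gr N := (mem_sdiff.1 hycl).1
  have hyB : y ∉ B := notMem_of_mem_sdiff_clF hBg hycl
  have hrk : rk N (insert y B) = q := by
    rw [rk_insert_of_mem_sdiff_clF hBg hycl, hBrk]
    omega
  have hcomp : rk N (gr N \ insert y B) = t := by
    rw [sdiff_insert_eq_sdiff_erase, rk_erase_of_notMem_coloops sdiff_subset (mem_sdiff.2 ⟨hyg, hyB⟩) hy.2, hBt]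
  rw [mem_filter, mem_levelSetCoQ]
  refine ⟨⟨⟨insert_subset hyg hBg, ?_⟩, ?_⟩, hcomp⟩
  · rw [← coe_rk, hrk]
  · rw [hcomp]

/-- **THE BOUNDARY PAIR IDENTITY** (`1 ≤ q`):
`Σ_{B′ : ρ(B′) = q−1, ρ(E∖B′) = t} #((E ∖ cl B′) ∖ coloops(E ∖ B′)) = Σ_{S ∈ T_t, ρ(E∖S) = t} #(coloops(S) ∩ cl(E ∖ S))`
— the pairs `(B′, y)` are counted through `(B′, y) ↦ (B′ ∪ y, y)`; the fibre over a boundary target `S` is the set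
of its coloops lying in `cl(E ∖ S)`. -/
theorem sum_card_boundary_pairs_eq (N : Matroid α) [N.Finite] (q t : ℕ) (hq : 1 ≤ q) :
    ∑ B ∈ (Rq N (q - 1)).filter (fun B => rk N (gr N \ B) = t),
        ((gr N \ clF N B) \ coloops N (gr N \ B)).card =
      ∑ S ∈ (levelSetCoQ N t q).filter (fun S => rk N (gr N \ S) = t),
        (coloops N S ∩ clF N (gr N \ S)).card := by
  set L := (Rq N (q - 1)).filter (fun B => rk N (gr N \ B) = t) with hL
  have hmemL : ∀ B ∈ L, B ∈ Rq N (q - 1) ∧ rk N (gr N \ B) = t := by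
    intro B hB
    rw [hL, mem_filter] at hB
    exact hB
  have h1 : ∑ B ∈ L, ((gr N \ clF N B) \ coloops N (gr N \ B)).card =
      ∑ p ∈ L.sigma (fun B => (gr N \ clF N B) \ coloops N (gr N \ B)), 1 := by
    rw [sum_sigma]
    simp only [sum_const, smul_eq_mul, mul_one]
  rw [h1]
  have hmaps : ∀ p ∈ L.sigma (fun B => (gr N \ clF N B) \ coloops N (gr N \ B)),
      insert p.2 p.1 ∈ (levelSetCoQ N t q).filter (fun S => rk N (gr N \ S) = t) := by
    rintro ⟨B, y⟩ hp
    rw [mem_sigma] at hp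
    obtain ⟨hB, hBt⟩ := hmemL B hp.1
    exact insert_mem_boundary_of_notMem_coloops hq hB hBt hp.2
  rw [← sum_fiberwise_of_maps_to hmaps]
  apply sum_congr rfl
  intro S hS
  rw [sum_const, smul_eq_mul, mul_one]
  rw [mem_filter] at hS
  obtain ⟨hST, hSt⟩ := hS
  obtain ⟨⟨hSg, hSr⟩, _⟩ := mem_levelSetCoQ.1 hST
  have hSrk : rk N S = q := rk_eq_of_eRk_eq_cq hSr
  have hfib : ∀ p : (Σ _ : Finset α, α),
      p ∈ (L.sigma (fun B => (gr N \ clF N B) \ coloops N (gr N \ B))).filter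
          (fun p => insert p.2 p.1 = S) ↔
        p.1 ∈ L ∧ p.2 ∈ (gr N \ clF N p.1) \ coloops N (gr N \ p.1) ∧ insert p.2 p.1 = S := by
    intro p
    rw [mem_filter, mem_sigma]
    tauto
  apply card_bij (fun p _ => p.2)
  · -- the pairs map into the coloops of `S` lying in `cl(E ∖ S)`
    rintro ⟨B, y⟩ hp
    obtain ⟨hBL, hy, hS⟩ := (hfib ⟨B, y⟩).1 hp
    obtain ⟨hB, _⟩ := hmemL B hBL
    obtain ⟨hBg, hBr⟩ := mem_Rq.1 hB
    have hBrk : rk N B = q - 1 := rk_eq_of_eRk_eq_cq hBr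
    rw [mem_sdiff] at hy
    have hyB : y ∉ B := notMem_of_mem_sdiff_clF hBg hy.1
    have hyg : y ∈ gr N := (mem_sdiff.1 hy.1).1
    simp only at hS
    have hyS : y ∈ S := by rw [← hS]; exact mem_insert_self _ _
    have hSB : S.erase y = B := by rw [← hS, erase_insert hyB]
    rw [mem_inter]
    constructor
    · apply mem_coloops_of_rk_erase hSg hyS
      rw [hSB, hBrk, hSrk]
      omega
    · -- `y` is not a coloop of `E ∖ B = (E ∖ S) ∪ y`, i.e. `y ∈ cl(E ∖ S)`
      have hcompl : gr N \ B = insert y (gr N \ S) := by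
        rw [← hSB, sdiff_erase_eq_insert_sdiff hSg hyS]
      have hnot := hy.2
      rw [hcompl, mem_coloops, not_and, not_not] at hnot
      have hyZ : y ∉ gr N \ S := fun h => (mem_sdiff.1 h).2 hyS
      have := hnot (mem_insert_self _ _)
      rwa [erase_insert hyZ] at this
  · -- injective: `B = S ∖ y`
    rintro ⟨B₁, y₁⟩ hp₁ ⟨B₂, y₂⟩ hp₂ heq
    simp only at heq
    subst heq
    obtain ⟨hBL₁, hy₁, hS₁⟩ := (hfib ⟨B₁, y₁⟩).1 hp₁
    obtain ⟨hBL₂, hy₂, hS₂⟩ := (hfib ⟨B₂, y₁⟩).1 hp₂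
    rw [mem_sdiff] at hy₁ hy₂
    have hyB₁ : y₁ ∉ B₁ := notMem_of_mem_sdiff_clF (mem_Rq.1 (hmemL B₁ hBL₁).1).1 hy₁.1
    have hyB₂ : y₁ ∉ B₂ := notMem_of_mem_sdiff_clF (mem_Rq.1 (hmemL B₂ hBL₂).1).1 hy₂.1
    have hB : B₁ = B₂ := by
      simp only at hS₁ hS₂
      rw [← erase_insert hyB₁, ← erase_insert hyB₂, hS₁, hS₂]
    subst hB
    rfl
  · -- surjective: a coloop `y ∈ cl(E ∖ S)` of `S` comes from `(S ∖ y, y)`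
    intro y hy
    rw [mem_inter] at hy
    obtain ⟨hyc, hycl⟩ := hy
    obtain ⟨hyS, hyclS⟩ := mem_coloops.1 hyc
    have hyZ : y ∉ gr N \ S := fun h => (mem_sdiff.1 h).2 hyS
    refine ⟨⟨S.erase y, y⟩, ?_, rfl⟩
    rw [hfib]
    refine ⟨?_, ?_, insert_erase hyS⟩
    · rw [hL, mem_filter]
      refine ⟨erase_mem_Rq_of_mem_coloops hST hq hyc, ?_⟩
      rw [sdiff_erase_eq_insert_sdiff hSg hyS, rk_insert_eq (hSg hyS) sdiff_subset, if_pos hycl, hSt]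
    · rw [mem_sdiff, mem_sdiff]
      refine ⟨⟨hSg hyS, hyclS⟩, ?_⟩
      rw [sdiff_erase_eq_insert_sdiff hSg hyS, mem_coloops, not_and, not_not]
      intro _
      rwa [erase_insert hyZ]

/-- **THE EXCESS FORM OF `(I_t)` ON RANK-`(q−1)` SETS** (`1 ≤ q`): `(I_t)` iff
`Σ_{L_t} ρ(E ∖ B) ≤ Σ_{L_t} #(E ∖ cl B) + Σ_{T_t} (q − κ(S)) + Σ_{B′ : ρ(B′) = q−1, ρ(E∖B′) = t} #((E ∖ cl B′) ∖ coloops(E ∖ B′))`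
— the demanding sets are paid by the dependent rank-`q` sets and by the sets one below the threshold, one unit per
outside non-coloop. -/
theorem thresholdIneq_iff_excess_coRank (hq : 1 ≤ q) :
    ThresholdIneq N q t ↔
      ∑ B ∈ (Rq N (q - 1)).filter (fun B => t + 1 ≤ rk N (gr N \ B)), rk N (gr N \ B) ≤
        ∑ B ∈ (Rq N (q - 1)).filter (fun B => t + 1 ≤ rk N (gr N \ B)), (gr N \ clF N B).card +
          (∑ S ∈ levelSetCoQ N t q, (q - (coloops N S).card) +
            ∑ B ∈ (Rq N (q - 1)).filter (fun B => rk N (gr N \ B) = t),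
              ((gr N \ clF N B) \ coloops N (gr N \ B)).card) := by
  rw [thresholdIneq_iff_excess_boundary hq, sum_card_boundary_pairs_eq N q t hq]

end BoundaryPairs

end PercRepro.Cogirth
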